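import Summits.QuantumFields.GaugeBoot.Rows.KZL2rpD3Labels
import Summits.QuantumFields.GaugeBoot.Eqs.BindKitN
import HarnessLib

/-!
# Gauge-boot: the kz-L2-rp-3D label decoder agrees with lean2's word decoder (all 4188 columns)

Cell `pub-gaugeboot`, seat lean1 (torus bindings of the kz-L2-rp-3D family, rows C15–C19 / C34–C40; GO-RP3D stage (C)).

HONEST FRAMING (page 1 of every file of this cell): certified bounds on lattice expectations at STATED coupling,
gauge group, dimension and torus size; NOT a mass gap, NOT a continuum limit, NOT a string tension, NOT large `N`.
The venture is explicitly NOT Yang–Mills-summit-bearing (barriers `FixedCouplingUltralocality`,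
`PerturbativeInvisibility`).

lean2's integer-coded aggregated rows (`Eqs/KZL2rpD3Z<tag>{U,L}`) name a variable by the DIGIT CODE of its label word, decoded by `BindN.wdg 3`;
this seat's bindings name it by the column `v` of the problem files, decoded by `KZL2rpD3.labelN` (`Rows/KZL2rpD3Labels`).  ONE kernel check
(flat ranges of 700) that the two decoders agree on all 4188 labels: `labelN_eq_wdg`, the `hlab` hypothesis of `AggBind4.sum_eq_of_walks3`.
Emitted by `work/rp3/kzbind3r.py gen`.
-/

noncomputable section

open Literature.MathematicalPhysics.QuantumFieldTheory

namespace Summit.QuantumFields.GaugeBoot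

namespace KZL2rpD3

set_option maxHeartbeats 0 in
/-- Columns `0 ≤ v < 700`: the two decoders agree (kernel). -/
theorem labelN_eq_wdg_0_700 : ∀ v < 700, 0 ≤ v → KZL2rpD3.labelN v = BindN.wdg 3 (KZL2rpD3.labelCode v) := by
  decide +kernel

set_option maxHeartbeats 0 in
/-- Columns `700 ≤ v < 1400`: the two decoders agree (kernel). -/
theorem labelN_eq_wdg_700_1400 : ∀ v < 1400, 700 ≤ v → KZL2rpD3.labelN v = BindN.wdg 3 (KZL2rpD3.labelCode v) := by
  decide +kernel

set_option maxHeartbeats 0 in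
/-- Columns `1400 ≤ v < 2100`: the two decoders agree (kernel). -/
theorem labelN_eq_wdg_1400_2100 : ∀ v < 2100, 1400 ≤ v → KZL2rpD3.labelN v = BindN.wdg 3 (KZL2rpD3.labelCode v) := by
  decide +kernel

set_option maxHeartbeats 0 in
/-- Columns `2100 ≤ v < 2800`: the two decoders agree (kernel). -/
theorem labelN_eq_wdg_2100_2800 : ∀ v < 2800, 2100 ≤ v → KZL2rpD3.labelN v = BindN.wdg 3 (KZL2rpD3.labelCode v) := by
  decide +kernel

set_option maxHeartbeats 0 in
/-- Columns `2800 ≤ v < 3500`: the two decoders agree (kernel). -/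
theorem labelN_eq_wdg_2800_3500 : ∀ v < 3500, 2800 ≤ v → KZL2rpD3.labelN v = BindN.wdg 3 (KZL2rpD3.labelCode v) := by
  decide +kernel

set_option maxHeartbeats 0 in
/-- Columns `3500 ≤ v < 4188`: the two decoders agree (kernel). -/
theorem labelN_eq_wdg_3500_4188 : ∀ v < 4188, 3500 ≤ v → KZL2rpD3.labelN v = BindN.wdg 3 (KZL2rpD3.labelCode v) := by
  decide +kernel

/-- **The two label decoders agree** on all 4188 columns. -/
theorem labelN_eq_wdg (v : ℕ) (hv : v < 4188) : KZL2rpD3.labelN v = BindN.wdg 3 (KZL2rpD3.labelCode v) := by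
  by_cases h0 : v < 700
  · exact labelN_eq_wdg_0_700 v h0 (Nat.zero_le _)
  by_cases h1 : v < 1400
  · exact labelN_eq_wdg_700_1400 v h1 (Nat.not_lt.mp h0)
  by_cases h2 : v < 2100
  · exact labelN_eq_wdg_1400_2100 v h2 (Nat.not_lt.mp h1)
  by_cases h3 : v < 2800
  · exact labelN_eq_wdg_2100_2800 v h3 (Nat.not_lt.mp h2)
  by_cases h4 : v < 3500
  · exact labelN_eq_wdg_2800_3500 v h4 (Nat.not_lt.mp h3)
  exact labelN_eq_wdg_3500_4188 v hv (Nat.not_lt.mp h4)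

end KZL2rpD3

end Summit.QuantumFields.GaugeBoot

end
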